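import Summits.QuantumAdvantage.QuantumAdvantage.Theorems.CubicForrelationNearExactIsExactFourModSixDigits
import Summits.QuantumAdvantage.QuantumAdvantage.Theorems.CubicForrelationNearExactIsExactSixteenTypeO
import Summits.QuantumAdvantage.QuantumAdvantage.Theorems.CubicForrelationNearExactIsExactZeroModSixSecondTypeO

/-!
# Crux `CubicForrelation.NearExactIsExact` (stmt-QuantumAdvantage-14043) — `n = 6r+4`, TWO-SIDED, second boundary: a type-O cubic never
  reaches `Φ = 1 − 2^{−(2r+1)}` (`r ≥ 2`)

Certificate seat `b2b-cforr-cert` (gen 8).  HONEST FRAMING: a theorem uniform in `r` about cubic Boolean pairs on `6r+4` bits (the type-O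
configuration at the SECOND dyadic boundary `1 − 2^{−⌊n/3⌋}` on `n ≡ 4 (mod 6)`); `r = 2` is the tree's `st_typeO_sixteen_lt` (gen 4); NOT
summit progress.

`f2_typeO_false`: for cubic `f, g : 𝔽₂^{(3r+2)+(3r+2)} → 𝔽₂` (`r ≥ 2`) with `W_g = 2^{2r+2}u`, ALL `u` odd and `Φ(f,g) ≥ 1 − (1/2)^{2r+1}`:
contradiction.  Proof: the budget `Σ(u − 2^r s)² = 2^{8r+5}(1−Φ) ≤ 2^{6r+4} = N` consists of `N` odd squares, so `τ := u − 2^r s = ±1`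
everywhere and `τ = (−1)^{d₁}` with the QUADRATIC digit `d₁ = [⌊u/2⌋ odd]` (`f2_digitOne`).  Let `R` be the radical of `d₁`.
* `16·#R < 2ⁿ`: three `B`-orthogonal hyperbolic pairs (`ss_extract3`) span a parametrised 6-flat with sign sum `±8` (`ss_flat_signsum6`), but
  the general 6-flat sums (`fs_flat_sum_dvd`: `16 ∣ Σ₆ u`; Ax: `2^r·Σ₆(−1)^f ∈ 2^{r+2}ℤ ⊆ 16ℤ`) force `Σ₆ τ ≡ 0 (mod 16)`;
* `16·#R ≥ 2ⁿ`: radical vectors are periods of `(−1)^{d₁}` up to sign, so (`fp_l1_sq_mul_le`) `(Σ|τ̂|)²·#R ≤ 2^{3n}`, `Σ|τ̂| ≤ 4N`, while the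
  pairing needs `Σ (−1)^g τ̂ = 2^{10r+6}(1−Φ) = 2^{2r+1}N ≥ 32N`.

References: J. Ax (1964) / R. J. McEliece (1972) (Carlet 2021 §4.1); MacWilliams–Sloane (1977) Ch. 15; R. O'Donnell (2014) §3.3.  Everything
below is proved from Mathlib and the tree; axioms are the standard three.
-/

set_option linter.dupNamespace false -- D-0017: single-problem summit ⇒ `QuantumAdvantage.QuantumAdvantage` by design

noncomputable section

namespace Summit.QuantumAdvantage.QuantumAdvantage.Theorems.CubicForrelation.NearExactIsExact

open Finset
open Literature.Computability.QuantumComplexity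
open Literature.Computability.QuantumComplexity.BuzetChailloux (bxor zeroVec bxor_bxor_cancel_left bxor_zeroVec zeroVec_bxor bxor_comm
  signOf_sq twist_bxor_right)
open Literature.Computability.QuantumComplexity.DerivativeWalsh (W sum_W_sq twist_bxor_left card_mul_card_perp)

/-- **A type-O cubic on `6r+4` bits never reaches `Φ = 1 − 2^{−(2r+1)}` (`r ≥ 2`).**  For cubic `f, g : 𝔽₂^{(3r+2)+(3r+2)} → 𝔽₂` with
`W_g = 2^{2r+2}u`, every `u(x)` odd and `Φ(f,g) ≥ 1 − (1/2)^{2r+1}`: contradiction (two-sided: residual `(−1)^{d₁}` with `d₁` quadratic;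
small radical ⇒ a 6-flat sign sum `±8` against `≡ 0 (mod 16)`; large radical ⇒ few frequencies against the pairing).  Uniform in `r`;
NOT summit progress. [this work] -/
theorem f2_typeO_false (r : ℕ) (hr : 2 ≤ r) (f g : (Fin ((3 * r + 2) + (3 * r + 2)) → Bool) → Bool) (hf : IsDegLeFun 3 f)
    (hg : IsDegLeFun 3 g) (u : (Fin ((3 * r + 2) + (3 * r + 2)) → Bool) → ℤ)
    (hu : ∀ x, W (fun y => signOf (g y)) x = (2 : ℝ) ^ (2 * r + 2) * (u x : ℝ)) (hodd : ∀ x, Odd (u x))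
    (hΦ : 1 - (1 / 2 : ℝ) ^ (2 * r + 1) ≤ forrelation f g) : False := by
  classical
  have hd1 : IsDegLeFun 2 (fun x => decide (Odd (u x / 2))) := f2_digitOne r g u hg hu
  obtain ⟨k, rfl⟩ : ∃ k, r = k + 2 := ⟨r - 2, by omega⟩
  -- (1) the budget is spent by `N` odd squares: `τ = ±1` everywhere, `T = N`
  have hbud := fms_budget (k + 2) f g u hu
  have hpow : (2 : ℝ) ^ (8 * (k + 2) + 5) * (1 / 2) ^ (2 * (k + 2) + 1) = 2 ^ (6 * k + 16) := by
    rw [one_div_pow]; field_simp; ring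
  have hT : (∑ x, (u x - 2 ^ (k + 2) * sZ (f x)) ^ 2 : ℤ) ≤ 2 ^ (6 * k + 16) := by
    have h1 : 1 - forrelation f g ≤ (1 / 2 : ℝ) ^ (2 * (k + 2) + 1) := by linarith
    have h' : ((∑ x, (u x - 2 ^ (k + 2) * sZ (f x)) ^ 2 : ℤ) : ℝ) ≤ (2 : ℝ) ^ (6 * k + 16) := by
      rw [hbud, ← hpow]
      exact mul_le_mul_of_nonneg_left h1 (by positivity)
    exact_mod_cast h'
  have hnonneg : ∀ x, 0 ≤ (u x - 2 ^ (k + 2) * sZ (f x)) ^ 2 - (1 : ℤ) := by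
    intro x
    have hodd' : Odd (u x - 2 ^ (k + 2) * sZ (f x)) := by
      have h2 : Even ((2 : ℤ) ^ (k + 2) * sZ (f x)) := by rw [pow_succ]; exact ⟨2 ^ (k + 1) * sZ (f x), by ring⟩
      exact Int.odd_sub.2 (iff_of_true (hodd x) h2)
    have h0 := Int.odd_iff.1 hodd'
    have : u x - 2 ^ (k + 2) * sZ (f x) ≤ -1 ∨ 1 ≤ u x - 2 ^ (k + 2) * sZ (f x) := by omega
    have := tp_sq_ge (k := 1) (by norm_num) this
    linarith
  have hNcard : (#(univ : Finset (Fin ((3 * (k + 2) + 2) + (3 * (k + 2) + 2)) → Bool)) : ℤ) = 2 ^ (6 * k + 16) := by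
    rw [card_univ, Fintype.card_fun, Fintype.card_bool, Fintype.card_fin]; push_cast; ring
  have hsum0 : ∑ x, ((u x - 2 ^ (k + 2) * sZ (f x)) ^ 2 - (1 : ℤ)) = 0 := by
    refine le_antisymm ?_ (sum_nonneg fun x _ => hnonneg x)
    rw [sum_sub_distrib, sum_const, nsmul_eq_mul, mul_one, hNcard]
    linarith
  have hτ : ∀ x, u x - 2 ^ (k + 2) * sZ (f x) = 1 ∨ u x - 2 ^ (k + 2) * sZ (f x) = -1 := by
    intro x
    have h := (sum_eq_zero_iff_of_nonneg fun y _ => hnonneg y).1 hsum0 x (mem_univ x)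
    have h1 : (u x - 2 ^ (k + 2) * sZ (f x)) * (u x - 2 ^ (k + 2) * sZ (f x)) = 1 := by rw [← pow_two]; linarith
    exact mul_self_eq_one_iff.1 h1
  have hTeq : (2 : ℝ) ^ (8 * (k + 2) + 5) * (1 - forrelation f g) = 2 ^ (6 * k + 16) := by
    have e : (∑ x, (u x - 2 ^ (k + 2) * sZ (f x)) ^ 2 : ℤ) = 2 ^ (6 * k + 16) := by
      have e1 : ∀ x, (u x - 2 ^ (k + 2) * sZ (f x)) ^ 2 = ((u x - 2 ^ (k + 2) * sZ (f x)) ^ 2 - 1) + 1 := fun x => by ring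
      rw [sum_congr rfl fun x _ => e1 x, sum_add_distrib, hsum0, sum_const, nsmul_eq_mul, mul_one, hNcard]; ring
    have h : ((∑ x, (u x - 2 ^ (k + 2) * sZ (f x)) ^ 2 : ℤ) : ℝ) = 2 ^ (6 * k + 16) := by exact_mod_cast e
    rw [hbud] at h
    exact h
  -- (2) the residual is the sign of the quadratic digit
  have h4c : ∀ x, (4 : ℤ) ∣ 2 ^ (k + 2) * sZ (f x) := fun x => ⟨2 ^ k * sZ (f x), by ring⟩
  have hτeq : ∀ x, u x - 2 ^ (k + 2) * sZ (f x) = sZ (decide (Odd (u x / 2))) := fun x => z2_tau_one (h4c x) (hτ x)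
  -- the pairing value
  have hpair := fms_pairing (k + 2) f g u hu
  have hfun : (fun x => (u x : ℝ) - (2 : ℝ) ^ (k + 2) * signOf (f x)) = fun x => signOf (decide (Odd (u x / 2))) := by
    funext x
    have e : (u x : ℝ) - (2 : ℝ) ^ (k + 2) * signOf (f x) = (((u x - 2 ^ (k + 2) * sZ (f x) : ℤ)) : ℝ) := by
      push_cast; rw [tp_sZ_cast]
    rw [e, hτeq x, tp_sZ_cast]
  rw [hfun] at hpair
  have hP : ∑ y, signOf (g y) * W (fun x => signOf (decide (Odd (u x / 2)))) y = (2 : ℝ) ^ (8 * k + 21) := by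
    rw [hpair, show (2 : ℝ) ^ (10 * (k + 2) + 6) = 2 ^ (2 * k + 5) * 2 ^ (8 * (k + 2) + 5) by ring, mul_assoc, hTeq]
    ring
  have hPle : (2 : ℝ) ^ (8 * k + 21) ≤ ∑ y, |W (fun x => signOf (decide (Odd (u x / 2)))) y| := by
    rw [← hP]; exact fl1_pairing_le_l1 g _
  -- the radical of `d₁`
  set R := univ.filter (fun a : Fin ((3 * (k + 2) + 2) + (3 * (k + 2) + 2)) → Bool => ∀ b,
    ((decide (Odd (u zeroVec / 2))) ^^ (decide (Odd (u a / 2))) ^^ (decide (Odd (u b / 2))) ^^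
      (decide (Odd (u (bxor a b) / 2)))) = false) with hRdef
  by_cases hR : 16 * #R < 2 ^ ((3 * (k + 2) + 2) + (3 * (k + 2) + 2))
  · -- (3a) three hyperbolic pairs and the 6-flat sign sum `±8`
    obtain ⟨a₀, a₁, a₂, a₃, a₄, a₅, h01, h23, h45, h02, h03, h12, h13, h04, h05, h14, h15, h24, h25, h34, h35⟩ :=
      ss_extract3 _ hd1 hR
    have hsig := ss_flat_signsum6 _ hd1 a₀ a₁ a₂ a₃ a₄ a₅ h01 h23 h45 h02 h03 h12 h13 h04 h05 h14 h15 h24 h25 h34 h35 zeroVec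
    have h16 := fs_flat_sum_dvd (e := 4) g u hg hu zeroVec ![a₀, a₁, a₂, a₃, a₄, a₅] (by omega)
    obtain ⟨zf, hzf⟩ := sl_sum_sZ_flat f hf zeroVec ![a₀, a₁, a₂, a₃, a₄, a₅]
    have hsf : (16 : ℤ) ∣ ∑ ε : Fin 6 → Bool, 2 ^ (k + 2) * sZ (f (fun j => zeroVec j ^^
        decide (Odd #(univ.filter fun i : Fin 6 => ε i &&
          (![a₀, a₁, a₂, a₃, a₄, a₅] : Fin 6 → Fin ((3 * (k + 2) + 2) + (3 * (k + 2) + 2)) → Bool) i j)))) := by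
      rw [← mul_sum, hzf]
      norm_num
      exact ⟨2 ^ k * zf, by ring⟩
    have h16' : (16 : ℤ) ∣ ∑ ε : Fin 6 → Bool, u (fun j => zeroVec j ^^
        decide (Odd #(univ.filter fun i : Fin 6 => ε i &&
          (![a₀, a₁, a₂, a₃, a₄, a₅] : Fin 6 → Fin ((3 * (k + 2) + 2) + (3 * (k + 2) + 2)) → Bool) i j))) := by
      have e16 : (2 : ℤ) ^ 4 = 16 := by norm_num
      rw [e16] at h16; exact h16
    have hτ16 : (16 : ℤ) ∣ ∑ ε : Fin 6 → Bool, sZ (decide (Odd (u (fun j => zeroVec j ^^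
        decide (Odd #(univ.filter fun i : Fin 6 => ε i &&
          (![a₀, a₁, a₂, a₃, a₄, a₅] : Fin 6 → Fin ((3 * (k + 2) + 2) + (3 * (k + 2) + 2)) → Bool) i j))) / 2))) := by
      rw [← sum_congr rfl fun ε _ => hτeq _, sum_sub_distrib]
      exact dvd_sub h16' hsf
    have hcast : ((∑ ε : Fin 6 → Bool, sZ (decide (Odd (u (fun j => zeroVec j ^^
        decide (Odd #(univ.filter fun i : Fin 6 => ε i &&
          (![a₀, a₁, a₂, a₃, a₄, a₅] : Fin 6 → Fin ((3 * (k + 2) + 2) + (3 * (k + 2) + 2)) → Bool) i j))) / 2))) : ℤ) : ℝ) =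
        ∑ ε : Fin 6 → Bool, signOf (decide (Odd (u (fun j => zeroVec j ^^
          decide (Odd #(univ.filter fun i : Fin 6 => ε i &&
            (![a₀, a₁, a₂, a₃, a₄, a₅] : Fin 6 → Fin ((3 * (k + 2) + 2) + (3 * (k + 2) + 2)) → Bool) i j))) / 2))) := by
      push_cast
      exact sum_congr rfl fun ε _ => tp_sZ_cast _
    rcases hsig with h | h
    · have h8 : (∑ ε : Fin 6 → Bool, sZ (decide (Odd (u (fun j => zeroVec j ^^
          decide (Odd #(univ.filter fun i : Fin 6 => ε i &&
            (![a₀, a₁, a₂, a₃, a₄, a₅] : Fin 6 → Fin ((3 * (k + 2) + 2) + (3 * (k + 2) + 2)) → Bool) i j))) / 2))) : ℤ) = 8 := by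
        have : ((∑ ε : Fin 6 → Bool, sZ (decide (Odd (u (fun j => zeroVec j ^^
          decide (Odd #(univ.filter fun i : Fin 6 => ε i &&
            (![a₀, a₁, a₂, a₃, a₄, a₅] : Fin 6 → Fin ((3 * (k + 2) + 2) + (3 * (k + 2) + 2)) → Bool) i j))) / 2))) : ℤ) : ℝ)
            = ((8 : ℤ) : ℝ) := by rw [hcast, h]; norm_num
        exact_mod_cast this
      rw [h8] at hτ16
      omega
    · have h8 : (∑ ε : Fin 6 → Bool, sZ (decide (Odd (u (fun j => zeroVec j ^^
          decide (Odd #(univ.filter fun i : Fin 6 => ε i &&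
            (![a₀, a₁, a₂, a₃, a₄, a₅] : Fin 6 → Fin ((3 * (k + 2) + 2) + (3 * (k + 2) + 2)) → Bool) i j))) / 2))) : ℤ) = -8 := by
        have : ((∑ ε : Fin 6 → Bool, sZ (decide (Odd (u (fun j => zeroVec j ^^
          decide (Odd #(univ.filter fun i : Fin 6 => ε i &&
            (![a₀, a₁, a₂, a₃, a₄, a₅] : Fin 6 → Fin ((3 * (k + 2) + 2) + (3 * (k + 2) + 2)) → Bool) i j))) / 2))) : ℤ) : ℝ)
            = ((-8 : ℤ) : ℝ) := by rw [hcast, h]; norm_num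
        exact_mod_cast this
      rw [h8] at hτ16
      omega
  · -- (3b) a large radical: few frequencies
    push Not at hR
    have hadd := es_B_add_left (fun x => decide (Odd (u x / 2))) hd1
    have hR0 : zeroVec ∈ R := by
      refine mem_filter.2 ⟨mem_univ _, fun b => ?_⟩
      rw [zeroVec_bxor]; cases decide (Odd (u zeroVec / 2)) <;> cases decide (Odd (u b / 2)) <;> rfl
    have hRadd : ∀ a ∈ R, ∀ a' ∈ R, bxor a a' ∈ R := by
      intro a ha a' ha'
      refine mem_filter.2 ⟨mem_univ _, fun b => ?_⟩
      rw [hadd, (mem_filter.1 ha).2 b, (mem_filter.1 ha').2 b]; rfl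
    set A₁ : (Fin ((3 * (k + 2) + 2) + (3 * (k + 2) + 2)) → Bool) → ℝ := fun x => signOf (decide (Odd (u x / 2))) with hA₁
    have hD : ∀ a ∈ R, ∀ x, decide (Odd (u (bxor x a) / 2)) =
        (decide (Odd (u x / 2)) ^^ (decide (Odd (u zeroVec / 2)) ^^ decide (Odd (u a / 2)))) := by
      intro a ha x
      have h := (mem_filter.1 ha).2 x
      rw [bxor_comm] at h
      revert h
      cases decide (Odd (u zeroVec / 2)) <;> cases decide (Odd (u a / 2)) <;> cases decide (Odd (u x / 2)) <;>
        cases decide (Odd (u (bxor x a) / 2)) <;> decide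
    have hN : (#(univ : Finset (Fin ((3 * (k + 2) + 2) + (3 * (k + 2) + 2)) → Bool)) : ℝ) =
        2 ^ ((3 * (k + 2) + 2) + (3 * (k + 2) + 2)) := by
      rw [card_univ, Fintype.card_fun, Fintype.card_bool, Fintype.card_fin]; push_cast; ring
    have h1b := fp_l1_sq_mul_le A₁ univ R (fun x _ => by simp only [A₁]; unfold signOf; split_ifs <;> simp)
      (fun x hx => absurd (mem_univ x) hx) hR0 hRadd (fun a ha => by
        refine ⟨signOf (decide (Odd (u zeroVec / 2)) ^^ decide (Odd (u a / 2))), ?_, fun x => ?_⟩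
        · unfold signOf; split_ifs <;> simp
        · simp only [A₁]; rw [hD a ha x, signOf_xor]; ring)
    rw [hN] at h1b
    have hRr : (2 : ℝ) ^ ((3 * (k + 2) + 2) + (3 * (k + 2) + 2)) ≤ 16 * (#R : ℝ) := by exact_mod_cast hR
    have hnn : 0 ≤ ∑ y, |W A₁ y| := sum_nonneg fun y _ => abs_nonneg _
    have hpos : (0 : ℝ) < 2 ^ ((3 * (k + 2) + 2) + (3 * (k + 2) + 2)) := by positivity
    -- `(Σ|Â₁|)² · 2ⁿ ≤ (Σ|Â₁|)² · 16#R ≤ 16 · 2^{3n}`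
    have hX2 : (∑ y, |W A₁ y|) ^ 2 ≤ (4 * (2 : ℝ) ^ ((3 * (k + 2) + 2) + (3 * (k + 2) + 2))) ^ 2 := by
      have h3 : (∑ y, |W A₁ y|) ^ 2 * 2 ^ ((3 * (k + 2) + 2) + (3 * (k + 2) + 2)) ≤
          (4 * (2 : ℝ) ^ ((3 * (k + 2) + 2) + (3 * (k + 2) + 2))) ^ 2 * 2 ^ ((3 * (k + 2) + 2) + (3 * (k + 2) + 2)) := by
        have hsqnn : 0 ≤ (∑ y, |W A₁ y|) ^ 2 := sq_nonneg _
        calc (∑ y, |W A₁ y|) ^ 2 * 2 ^ ((3 * (k + 2) + 2) + (3 * (k + 2) + 2))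
            ≤ (∑ y, |W A₁ y|) ^ 2 * (16 * (#R : ℝ)) := mul_le_mul_of_nonneg_left hRr hsqnn
          _ = 16 * ((∑ y, |W A₁ y|) ^ 2 * (#R : ℝ)) := by ring
          _ ≤ 16 * ((2 : ℝ) ^ ((3 * (k + 2) + 2) + (3 * (k + 2) + 2)) * 2 ^ ((3 * (k + 2) + 2) + (3 * (k + 2) + 2)) *
              2 ^ ((3 * (k + 2) + 2) + (3 * (k + 2) + 2))) := mul_le_mul_of_nonneg_left h1b (by norm_num)
          _ = (4 * (2 : ℝ) ^ ((3 * (k + 2) + 2) + (3 * (k + 2) + 2))) ^ 2 * 2 ^ ((3 * (k + 2) + 2) + (3 * (k + 2) + 2)) := by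
              ring
      exact le_of_mul_le_mul_right h3 hpos
    have hX : ∑ y, |W A₁ y| ≤ 4 * (2 : ℝ) ^ ((3 * (k + 2) + 2) + (3 * (k + 2) + 2)) :=
      (pow_le_pow_iff_left₀ hnn (by positivity) two_ne_zero).1 hX2
    have hbig : (8 : ℝ) * 2 ^ ((3 * (k + 2) + 2) + (3 * (k + 2) + 2)) ≤ 2 ^ (8 * k + 21) := by
      have e8 : (2 : ℝ) ^ (8 * k + 21) = 2 ^ (2 * k + 2) * (8 * 2 ^ ((3 * (k + 2) + 2) + (3 * (k + 2) + 2))) := by ring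
      rw [e8]
      have h1 : (1 : ℝ) ≤ 2 ^ (2 * k + 2) := one_le_pow₀ (by norm_num)
      have h2 : (0 : ℝ) ≤ 8 * 2 ^ ((3 * (k + 2) + 2) + (3 * (k + 2) + 2)) := by positivity
      exact le_mul_of_one_le_left h2 h1
    have hA₁W : ∑ y, |W (fun x => signOf (decide (Odd (u x / 2)))) y| = ∑ y, |W A₁ y| := rfl
    rw [hA₁W] at hPle
    linarith

end Summit.QuantumAdvantage.QuantumAdvantage.Theorems.CubicForrelation.NearExactIsExact

end
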